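import Summits.QuantumFields.YangMills.Theorems.ColdStartUniversalityEntropyFlowTools
import HarnessLib

/-!
# Route `ColdStartUniversality` (fixed-cut-off package, entropy side): SUB-ADDITIVITY (TENSORISATION) OF ENTROPY over a product of
# two probability spaces — the abstract brick behind «log-Sobolev inequalities tensorise» (Bakry–Gentil–Ledoux Prop. 5.2.7)

Helper file (seat `ym-line-csu-p1`, g21; `--supports stmt-QuantumFields-27363`), abstract measure theory in the toolkit namespace
`…ColdStartUniversality.EntropyFlow` (no SZZ object).  For probability measures `μ` on `X`, `ν` on `Y`, a measurable `f : X × Y → ℝ`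
with `0 < δ ≤ f ≤ M`, and `Ent_ρ(φ) = ∫ φ log φ dρ − (∫ φ dρ) log(∫ φ dρ)`:

* ★ `integral_mul_le_entropy_add` — the ENTROPY (Donsker–Varadhan / Gibbs) INEQUALITY `∫ φ h dρ ≤ Ent_ρ(φ) + (∫ φ dρ) log ∫ e^h dρ`
  (Gibbs' inequality `integral_mul_log_le_integral_mul_log` against the tilted density `(∫φ) e^h/∫e^h`);
* ★ `entropy_prod_eq` — the CHAIN RULE `Ent_{μ⊗ν}(f) = ∫ Ent_ν(f(x,·)) dμ(x) + Ent_μ(x ↦ ∫ f(x,y) dν(y))`;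
* ★ `entropy_marginal_le` — CONVEXITY `Ent_μ(x ↦ ∫ f(x,y) dν(y)) ≤ ∫ Ent_μ(f(·,y)) dν(y)` (the entropy inequality at the optimal
  `h = log(G/∫G)`, Fubini);
* ★★ `entropy_prod_le` — SUB-ADDITIVITY `Ent_{μ⊗ν}(f) ≤ ∫ Ent_ν(f(x,·)) dμ(x) + ∫ Ent_μ(f(·,y)) dν(y)`.

With the one-factor log-Sobolev inequalities applied inside the two integrals this is the tensorisation of log-Sobolev inequalities
(product carré du champ = sum of the factor ones), the route to the log-Sobolev inequality for the product Haar measure on `SU(2)^E`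
from the one-link one (`Literature…SUNBakryEmery.logSobolev_haar`, g20) — not done here.
THEOREMS ONLY, no definition, no sorry, [folklore]/[cite] BGL.  Nothing here is specific to Yang–Mills; no crux, rung or summit
statement is proved; the Yang–Mills mass gap is NOT proved.
-/

set_option autoImplicit false

noncomputable section

namespace Summit.QuantumFields.YangMills.Theorems.ColdStartUniversality.EntropyFlow

open MeasureTheory Filter Set Topology Real Function
open scoped NNReal ENNReal

/-! ## §1. The entropy inequality -/

/-- ★ **The entropy inequality** (Donsker–Varadhan lower bound): for a probability measure `ρ`, a measurable `φ` with
`0 < δ ≤ φ ≤ M` and a measurable `h` with `|h| ≤ B`, `∫ φ h dρ ≤ Ent_ρ(φ) + (∫ φ dρ) · log(∫ e^h dρ)`.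
[cite: BakryGentilLedoux2014, (5.1.2) and Prop. 5.2.7 (proof)] -/
theorem integral_mul_le_entropy_add {X : Type*} [MeasurableSpace X] (ρ : Measure X) [IsProbabilityMeasure ρ]
    {φ h : X → ℝ} (hφm : Measurable φ) (hhm : Measurable h) {δ M B : ℝ} (hδ : 0 < δ) (hφδ : ∀ x, δ ≤ φ x)
    (hφM : ∀ x, φ x ≤ M) (hhB : ∀ x, |h x| ≤ B) :
    ∫ x, φ x * h x ∂ρ ≤
      ((∫ x, φ x * Real.log (φ x) ∂ρ) - (∫ x, φ x ∂ρ) * Real.log (∫ x, φ x ∂ρ)) +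
        (∫ x, φ x ∂ρ) * Real.log (∫ x, Real.exp (h x) ∂ρ) := by
  rcases isEmpty_or_nonempty X with hX | hX
  · have e : ∀ g : X → ℝ, ∫ x, g x ∂ρ = 0 := fun g => by rw [Measure.eq_zero_of_isEmpty ρ]; simp
    simp only [e]; simp
  have hφpos : ∀ x, 0 < φ x := fun x => lt_of_lt_of_le hδ (hφδ x)
  -- integrability
  have hφb : ∀ x, |φ x| ≤ M := fun x => by rw [abs_of_pos (hφpos x)]; exact hφM x
  have iφ : Integrable φ ρ := Integrable.of_bound hφm.aestronglyMeasurable M (ae_of_all _ fun x => by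
    rw [Real.norm_eq_abs]; exact hφb x)
  have ieh : Integrable (fun x => Real.exp (h x)) ρ :=
    Integrable.of_bound (hhm.exp).aestronglyMeasurable (Real.exp B) (ae_of_all _ fun x => by
      rw [Real.norm_eq_abs, abs_of_pos (Real.exp_pos _)]
      exact Real.exp_le_exp.2 ((le_abs_self _).trans (hhB x)))
  have iφh : Integrable (fun x => φ x * h x) ρ := Integrable.of_bound (hφm.mul hhm).aestronglyMeasurable (M * B)
    (ae_of_all _ fun x => by rw [Real.norm_eq_abs, abs_mul]; exact mul_le_mul (hφb x) (hhB x) (abs_nonneg _) ((abs_nonneg _).trans (hφb x)))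
  obtain ⟨C, hC⟩ := (isCompact_Icc (a := δ) (b := M)).exists_bound_of_continuousOn
    (Real.continuousOn_log.mono fun x hx => ne_of_gt (lt_of_lt_of_le hδ hx.1))
  have hlogb : ∀ x, |Real.log (φ x)| ≤ C := fun x => by
    have := hC (φ x) ⟨hφδ x, hφM x⟩; rwa [Real.norm_eq_abs] at this
  have iφl : Integrable (fun x => φ x * Real.log (φ x)) ρ :=
    Integrable.of_bound (hφm.mul (Real.measurable_log.comp hφm)).aestronglyMeasurable (M * C)
      (ae_of_all _ fun x => by rw [Real.norm_eq_abs, abs_mul]; exact mul_le_mul (hφb x) (hlogb x) (abs_nonneg _) ((abs_nonneg _).trans (hφb x)))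
  -- the constants
  set m : ℝ := ∫ x, φ x ∂ρ with hm
  set Z : ℝ := ∫ x, Real.exp (h x) ∂ρ with hZ
  have hmpos : 0 < m := by
    rw [hm]
    calc (0 : ℝ) < δ := hδ
      _ = ∫ _x, δ ∂ρ := by rw [integral_const, probReal_univ, one_smul]
      _ ≤ ∫ x, φ x ∂ρ := integral_mono (integrable_const δ) iφ hφδ
  have hZpos : 0 < Z := by
    rw [hZ]
    calc (0 : ℝ) < Real.exp (-B) := Real.exp_pos _
      _ = ∫ _x, Real.exp (-B) ∂ρ := by rw [integral_const, probReal_univ, one_smul]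
      _ ≤ ∫ x, Real.exp (h x) ∂ρ := integral_mono (integrable_const _) ieh fun x =>
          Real.exp_le_exp.2 (by linarith [neg_abs_le (h x), hhB x])
  -- the tilted density `ψ = m e^h / Z`, of mass `m`
  set ψ : X → ℝ := fun x => m * Real.exp (h x) / Z with hψ
  have hψpos : ∀ x, 0 < ψ x := fun x => div_pos (mul_pos hmpos (Real.exp_pos _)) hZpos
  have iψ : Integrable ψ ρ := (ieh.const_mul m).div_const Z
  have hmass : ∫ x, ψ x ∂ρ = ∫ x, φ x ∂ρ := by
    simp only [hψ]
    rw [integral_div, integral_const_mul, ← hZ, mul_div_assoc, div_self hZpos.ne', mul_one]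
  have hlogψ : ∀ x, Real.log (ψ x) = Real.log m + h x - Real.log Z := fun x => by
    simp only [hψ]
    rw [Real.log_div (mul_pos hmpos (Real.exp_pos _)).ne' hZpos.ne', Real.log_mul hmpos.ne' (Real.exp_pos _).ne', Real.log_exp]
  have iφlψ : Integrable (fun x => φ x * Real.log (ψ x)) ρ := by
    have : Integrable (fun x => φ x * Real.log m + φ x * h x - φ x * Real.log Z) ρ :=
      ((iφ.mul_const _).add iφh).sub (iφ.mul_const _)
    exact this.congr (ae_of_all _ fun x => by simp only [hlogψ]; ring)
  -- Gibbs
  have hG := integral_mul_log_le_integral_mul_log (ν := ρ) (fun x => (hφpos x).le) hψpos iφ iψ iφlψ iφl hmass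
  have e : ∫ x, φ x * Real.log (ψ x) ∂ρ = m * Real.log m + (∫ x, φ x * h x ∂ρ) - m * Real.log Z := by
    have ee : ∀ x, φ x * Real.log (ψ x) = φ x * Real.log m + φ x * h x - φ x * Real.log Z := fun x => by
      rw [hlogψ]; ring
    simp_rw [ee]
    have iA : Integrable (fun x => φ x * Real.log m + φ x * h x) ρ := (iφ.mul_const _).add iφh
    have iB : Integrable (fun x => φ x * Real.log Z) ρ := iφ.mul_const _
    have iC : Integrable (fun x => φ x * Real.log m) ρ := iφ.mul_const _
    rw [integral_sub iA iB, integral_add iC iφh, integral_mul_const, integral_mul_const]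
  rw [e] at hG
  linarith

/-! ## §2. The chain rule and the convexity of entropy -/

section Product

variable {X Y : Type*} [MeasurableSpace X] [MeasurableSpace Y] (μ : Measure X) (ν : Measure Y)
  [IsProbabilityMeasure μ] [IsProbabilityMeasure ν]

/-- ★ **Chain rule for the entropy on a product**: for measurable `f : X × Y → ℝ` with `0 < δ ≤ f ≤ M`,
`Ent_{μ⊗ν}(f) = ∫ Ent_ν(f(x,·)) dμ(x) + Ent_μ(x ↦ ∫ f(x,y) dν(y))` (Fubini; the marginal `G(x) = ∫ f(x,y) dν` has the same mass).
[cite: BakryGentilLedoux2014, Prop. 5.2.7 (proof)] -/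
theorem entropy_prod_eq {f : X × Y → ℝ} (hfm : Measurable f) {δ M : ℝ} (hδ : 0 < δ) (hfδ : ∀ p, δ ≤ f p) (hfM : ∀ p, f p ≤ M) :
    (∫ p, f p * Real.log (f p) ∂(μ.prod ν)) - (∫ p, f p ∂(μ.prod ν)) * Real.log (∫ p, f p ∂(μ.prod ν)) =
      (∫ x, ((∫ y, f (x, y) * Real.log (f (x, y)) ∂ν) - (∫ y, f (x, y) ∂ν) * Real.log (∫ y, f (x, y) ∂ν)) ∂μ) +
      ((∫ x, (∫ y, f (x, y) ∂ν) * Real.log (∫ y, f (x, y) ∂ν) ∂μ) -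
        (∫ x, (∫ y, f (x, y) ∂ν) ∂μ) * Real.log (∫ x, (∫ y, f (x, y) ∂ν) ∂μ)) := by
  have hfpos : ∀ p, 0 < f p := fun p => lt_of_lt_of_le hδ (hfδ p)
  have hfb : ∀ p, |f p| ≤ M := fun p => by rw [abs_of_pos (hfpos p)]; exact hfM p
  obtain ⟨C, hC⟩ := (isCompact_Icc (a := δ) (b := M)).exists_bound_of_continuousOn
    (Real.continuousOn_log.mono fun x hx => ne_of_gt (lt_of_lt_of_le hδ hx.1))
  have hlogb : ∀ p, |Real.log (f p)| ≤ C := fun p => by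
    have := hC (f p) ⟨hfδ p, hfM p⟩; rwa [Real.norm_eq_abs] at this
  have hflm : Measurable fun p => f p * Real.log (f p) := hfm.mul (Real.measurable_log.comp hfm)
  have i_f : Integrable f (μ.prod ν) := Integrable.of_bound hfm.aestronglyMeasurable M
    (ae_of_all _ fun p => by rw [Real.norm_eq_abs]; exact hfb p)
  have i_fl : Integrable (fun p => f p * Real.log (f p)) (μ.prod ν) :=
    Integrable.of_bound hflm.aestronglyMeasurable (M * C) (ae_of_all _ fun p => by
      rw [Real.norm_eq_abs, abs_mul]; exact mul_le_mul (hfb p) (hlogb p) (abs_nonneg _) ((abs_nonneg _).trans (hfb p)))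
  -- Fubini on `f` and `f log f`
  rw [integral_prod _ i_fl, integral_prod _ i_f]
  -- the inner integrals are bounded measurable functions of `x`
  have hGm : Measurable fun x => ∫ y, f (x, y) ∂ν := (hfm.stronglyMeasurable.integral_prod_right' (ν := ν)).measurable
  have hGb : ∀ x, |∫ y, f (x, y) ∂ν| ≤ M := fun x => by
    have h1 : |∫ y, f (x, y) ∂ν| ≤ ∫ y, |f (x, y)| ∂ν := abs_integral_le_integral_abs
    refine h1.trans ?_
    have := integral_mono (μ := ν) ((Integrable.of_bound (hfm.comp measurable_prodMk_left).aestronglyMeasurable M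
      (ae_of_all _ fun y => by rw [Real.norm_eq_abs]; exact hfb (x, y))).abs) (integrable_const M) fun y => hfb (x, y)
    rwa [integral_const, probReal_univ, one_smul] at this
  have hGlogm : Measurable fun x => (∫ y, f (x, y) ∂ν) * Real.log (∫ y, f (x, y) ∂ν) :=
    hGm.mul (Real.measurable_log.comp hGm)
  have hGδ : ∀ x, δ ≤ ∫ y, f (x, y) ∂ν := fun x => by
    have := integral_mono (μ := ν) (integrable_const δ) (Integrable.of_bound (hfm.comp measurable_prodMk_left).aestronglyMeasurable M
      (ae_of_all _ fun y => by rw [Real.norm_eq_abs]; exact hfb (x, y))) fun y => hfδ (x, y)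
    rwa [integral_const, probReal_univ, one_smul] at this
  have hGlogb : ∀ x, |(∫ y, f (x, y) ∂ν) * Real.log (∫ y, f (x, y) ∂ν)| ≤ M * C := fun x => by
    rw [abs_mul]
    have h2 : |Real.log (∫ y, f (x, y) ∂ν)| ≤ C := by
      have := hC _ ⟨hGδ x, (le_abs_self _).trans (hGb x)⟩; rwa [Real.norm_eq_abs] at this
    exact mul_le_mul (hGb x) h2 (abs_nonneg _) ((abs_nonneg _).trans (hGb x))
  have iGlog : Integrable (fun x => (∫ y, f (x, y) ∂ν) * Real.log (∫ y, f (x, y) ∂ν)) μ :=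
    Integrable.of_bound hGlogm.aestronglyMeasurable (M * C) (ae_of_all _ fun x => by rw [Real.norm_eq_abs]; exact hGlogb x)
  have iIfl : Integrable (fun x => ∫ y, f (x, y) * Real.log (f (x, y)) ∂ν) μ := i_fl.integral_prod_left
  rw [integral_sub iIfl iGlog]
  ring

/-- ★ **Convexity of the entropy** (Jensen for `Ent_μ`): `Ent_μ(x ↦ ∫ f(x,y) dν(y)) ≤ ∫ Ent_μ(f(·,y)) dν(y)` for measurable
`f : X × Y → ℝ` with `0 < δ ≤ f ≤ M` — the entropy inequality at `h = log(G/∫G dμ)`, `G(x) = ∫ f(x,y) dν`, then Fubini.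
[cite: BakryGentilLedoux2014, Prop. 5.2.7 (proof)] -/
theorem entropy_marginal_le {f : X × Y → ℝ} (hfm : Measurable f) {δ M : ℝ} (hδ : 0 < δ) (hfδ : ∀ p, δ ≤ f p) (hfM : ∀ p, f p ≤ M) :
    (∫ x, (∫ y, f (x, y) ∂ν) * Real.log (∫ y, f (x, y) ∂ν) ∂μ) -
        (∫ x, (∫ y, f (x, y) ∂ν) ∂μ) * Real.log (∫ x, (∫ y, f (x, y) ∂ν) ∂μ) ≤
      ∫ y, ((∫ x, f (x, y) * Real.log (f (x, y)) ∂μ) - (∫ x, f (x, y) ∂μ) * Real.log (∫ x, f (x, y) ∂μ)) ∂ν := by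
  rcases isEmpty_or_nonempty X with hX | hX
  · have e : ∀ g : X → ℝ, ∫ x, g x ∂μ = 0 := fun g => by rw [Measure.eq_zero_of_isEmpty μ]; simp
    simp only [e]; simp
  have hfpos : ∀ p, 0 < f p := fun p => lt_of_lt_of_le hδ (hfδ p)
  have hfb : ∀ p, |f p| ≤ M := fun p => by rw [abs_of_pos (hfpos p)]; exact hfM p
  have hM : δ ≤ M := by
    rcases isEmpty_or_nonempty Y with hY | hY
    · -- no `Y`: `ν` cannot be a probability measure
      exact absurd (measure_univ (μ := ν)) (by rw [Measure.eq_zero_of_isEmpty ν]; simp)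
    · exact (hfδ (Classical.arbitrary _, Classical.arbitrary _)).trans (hfM _)
  obtain ⟨C, hC⟩ := (isCompact_Icc (a := δ) (b := M)).exists_bound_of_continuousOn
    (Real.continuousOn_log.mono fun x hx => ne_of_gt (lt_of_lt_of_le hδ hx.1))
  have i_f : Integrable f (μ.prod ν) := Integrable.of_bound hfm.aestronglyMeasurable M
    (ae_of_all _ fun p => by rw [Real.norm_eq_abs]; exact hfb p)
  -- the marginal `G`
  set G : X → ℝ := fun x => ∫ y, f (x, y) ∂ν with hG
  have hGm : Measurable G := (hfm.stronglyMeasurable.integral_prod_right' (ν := ν)).measurable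
  have ify : ∀ x, Integrable (fun y => f (x, y)) ν := fun x =>
    Integrable.of_bound (hfm.comp measurable_prodMk_left).aestronglyMeasurable M
      (ae_of_all _ fun y => by rw [Real.norm_eq_abs]; exact hfb (x, y))
  have hGδ : ∀ x, δ ≤ G x := fun x => by
    have := integral_mono (μ := ν) (integrable_const δ) (ify x) fun y => hfδ (x, y)
    rwa [integral_const, probReal_univ, one_smul] at this
  have hGM : ∀ x, G x ≤ M := fun x => by
    have := integral_mono (μ := ν) (ify x) (integrable_const M) fun y => hfM (x, y)
    rwa [integral_const, probReal_univ, one_smul] at this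
  have hGpos : ∀ x, 0 < G x := fun x => lt_of_lt_of_le hδ (hGδ x)
  have iG : Integrable G μ := Integrable.of_bound hGm.aestronglyMeasurable M
    (ae_of_all _ fun x => by rw [Real.norm_eq_abs, abs_of_pos (hGpos x)]; exact hGM x)
  set mG : ℝ := ∫ x, G x ∂μ with hmG
  have hmGpos : 0 < mG := by
    rw [hmG]
    calc (0 : ℝ) < δ := hδ
      _ = ∫ _x, δ ∂μ := by rw [integral_const, probReal_univ, one_smul]
      _ ≤ ∫ x, G x ∂μ := integral_mono (integrable_const δ) iG hGδ
  have hmGM : mG ≤ M := by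
    have := integral_mono iG (integrable_const M) hGM
    rwa [integral_const, probReal_univ, one_smul] at this
  have hmGδ : δ ≤ mG := by
    have := integral_mono (integrable_const δ) iG hGδ
    rwa [integral_const, probReal_univ, one_smul] at this
  -- the optimal `h = log G − log mG`, bounded by `2C`
  have hlogb : ∀ t, δ ≤ t → t ≤ M → |Real.log t| ≤ C := fun t h1 h2 => by
    have := hC t ⟨h1, h2⟩; rwa [Real.norm_eq_abs] at this
  set h : X → ℝ := fun x => Real.log (G x) - Real.log mG with hh
  have hhm : Measurable h := (Real.measurable_log.comp hGm).sub measurable_const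
  have hhB : ∀ x, |h x| ≤ C + C := fun x =>
    (abs_sub _ _).trans (add_le_add (hlogb _ (hGδ x) (hGM x)) (hlogb _ hmGδ hmGM))
  -- `∫ e^h dμ = 1` and `Ent_μ(G) = ∫ G h dμ`
  have hexp : ∀ x, Real.exp (h x) = G x / mG := fun x => by
    simp only [hh]; rw [Real.exp_sub, Real.exp_log (hGpos x), Real.exp_log hmGpos]
  have hZ : ∫ x, Real.exp (h x) ∂μ = 1 := by
    simp_rw [hexp]; rw [integral_div, ← hmG, div_self hmGpos.ne']
  have iGlog : Integrable (fun x => G x * Real.log (G x)) μ :=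
    Integrable.of_bound (hGm.mul (Real.measurable_log.comp hGm)).aestronglyMeasurable (M * C) (ae_of_all _ fun x => by
      rw [Real.norm_eq_abs, abs_mul, abs_of_pos (hGpos x)]
      exact mul_le_mul (hGM x) (hlogb _ (hGδ x) (hGM x)) (abs_nonneg _) ((hGpos x).le.trans (hGM x)))
  have hEntG : (∫ x, G x * Real.log (G x) ∂μ) - mG * Real.log mG = ∫ x, G x * h x ∂μ := by
    have ee : ∀ x, G x * h x = G x * Real.log (G x) - G x * Real.log mG := fun x => by simp only [hh]; ring
    simp_rw [ee]
    rw [integral_sub iGlog (iG.mul_const _), integral_mul_const]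
  -- Fubini: `∫ G h dμ = ∫∫ f(x,y) h(x) dν dμ = ∫ (∫ f(x,y) h(x) dμ) dν`
  have hFHm : Measurable fun p : X × Y => f p * h p.1 := hfm.mul (hhm.comp measurable_fst)
  have hFHb : ∀ p : X × Y, |f p * h p.1| ≤ M * (C + C) := fun p => by
    rw [abs_mul]; exact mul_le_mul (hfb p) (hhB p.1) (abs_nonneg _) ((abs_nonneg _).trans (hfb p))
  have iFH : Integrable (fun p : X × Y => f p * h p.1) (μ.prod ν) :=
    Integrable.of_bound hFHm.aestronglyMeasurable (M * (C + C)) (ae_of_all _ fun p => by rw [Real.norm_eq_abs]; exact hFHb p)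
  have hswap : ∫ x, G x * h x ∂μ = ∫ y, (∫ x, f (x, y) * h x ∂μ) ∂ν := by
    have e1 : ∀ x, G x * h x = ∫ y, f (x, y) * h x ∂ν := fun x => by
      simp only [hG]; rw [integral_mul_const]
    simp_rw [e1]
    exact integral_integral_swap (f := fun x y => f (x, y) * h x) iFH
  -- the entropy inequality for each `y`
  have hpt : ∀ y, (∫ x, f (x, y) * h x ∂μ) ≤
      (∫ x, f (x, y) * Real.log (f (x, y)) ∂μ) - (∫ x, f (x, y) ∂μ) * Real.log (∫ x, f (x, y) ∂μ) := by
    intro y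
    have h1 := integral_mul_le_entropy_add μ (φ := fun x => f (x, y)) (hfm.comp measurable_prodMk_right) hhm hδ
      (fun x => hfδ (x, y)) (fun x => hfM (x, y)) hhB
    rw [hZ, Real.log_one, mul_zero, add_zero] at h1
    exact h1
  -- integrate over `y`: both sides are bounded measurable functions of `y`
  have hflm : Measurable fun p : X × Y => f p * Real.log (f p) := hfm.mul (Real.measurable_log.comp hfm)
  have hLm : Measurable fun y => ∫ x, f (x, y) * h x ∂μ :=
    (hFHm.stronglyMeasurable.integral_prod_left' (μ := μ)).measurable
  have hR1m : Measurable fun y => ∫ x, f (x, y) * Real.log (f (x, y)) ∂μ :=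
    (hflm.stronglyMeasurable.integral_prod_left' (μ := μ)).measurable
  have hR2m : Measurable fun y => ∫ x, f (x, y) ∂μ := (hfm.stronglyMeasurable.integral_prod_left' (μ := μ)).measurable
  have ifx : ∀ y, Integrable (fun x => f (x, y)) μ := fun y =>
    Integrable.of_bound (hfm.comp measurable_prodMk_right).aestronglyMeasurable M
      (ae_of_all _ fun x => by rw [Real.norm_eq_abs]; exact hfb (x, y))
  have hHδ : ∀ y, δ ≤ ∫ x, f (x, y) ∂μ := fun y => by
    have := integral_mono (integrable_const δ) (ifx y) fun x => hfδ (x, y)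
    rwa [integral_const, probReal_univ, one_smul] at this
  have hHM : ∀ y, ∫ x, f (x, y) ∂μ ≤ M := fun y => by
    have := integral_mono (ifx y) (integrable_const M) fun x => hfM (x, y)
    rwa [integral_const, probReal_univ, one_smul] at this
  have hbound_int : ∀ (g : X → ℝ) (B : ℝ), Measurable g → (∀ x, |g x| ≤ B) → |∫ x, g x ∂μ| ≤ B := fun g B hg hB => by
    refine (abs_integral_le_integral_abs).trans ?_
    have := integral_mono (μ := μ) ((Integrable.of_bound hg.aestronglyMeasurable B
      (ae_of_all _ fun x => by rw [Real.norm_eq_abs]; exact hB x)).abs) (integrable_const B) hB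
    rwa [integral_const, probReal_univ, one_smul] at this
  have iL : Integrable (fun y => ∫ x, f (x, y) * h x ∂μ) ν :=
    Integrable.of_bound hLm.aestronglyMeasurable (M * (C + C)) (ae_of_all _ fun y => by
      rw [Real.norm_eq_abs]
      exact hbound_int (fun x => f (x, y) * h x) _ (hfm.comp measurable_prodMk_right |>.mul hhm) fun x => hFHb (x, y))
  have iR : Integrable (fun y => (∫ x, f (x, y) * Real.log (f (x, y)) ∂μ) -
      (∫ x, f (x, y) ∂μ) * Real.log (∫ x, f (x, y) ∂μ)) ν := by
    refine Integrable.of_bound ((hR1m.sub (hR2m.mul (Real.measurable_log.comp hR2m))).aestronglyMeasurable)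
      (M * C + M * C) (ae_of_all _ fun y => ?_)
    rw [Real.norm_eq_abs]
    refine (abs_sub _ _).trans (add_le_add ?_ ?_)
    · exact hbound_int (fun x => f (x, y) * Real.log (f (x, y))) (M * C)
        ((hfm.comp measurable_prodMk_right).mul (Real.measurable_log.comp (hfm.comp measurable_prodMk_right)))
        (fun x => by
          rw [abs_mul]
          exact mul_le_mul (hfb (x, y)) (hlogb _ (hfδ (x, y)) (hfM (x, y))) (abs_nonneg _) ((abs_nonneg _).trans (hfb (x, y))))
    · rw [abs_mul, abs_of_nonneg (hδ.le.trans (hHδ y))]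
      exact mul_le_mul (hHM y) (hlogb _ (hHδ y) (hHM y)) (abs_nonneg _) (hδ.le.trans hM)
  calc (∫ x, G x * Real.log (G x) ∂μ) - mG * Real.log mG = ∫ x, G x * h x ∂μ := hEntG
    _ = ∫ y, (∫ x, f (x, y) * h x ∂μ) ∂ν := hswap
    _ ≤ ∫ y, ((∫ x, f (x, y) * Real.log (f (x, y)) ∂μ) - (∫ x, f (x, y) ∂μ) * Real.log (∫ x, f (x, y) ∂μ)) ∂ν :=
        integral_mono iL iR hpt

/-- ★★ **Sub-additivity (tensorisation) of the entropy**: for probability measures `μ, ν` and a measurable `f : X × Y → ℝ` with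
`0 < δ ≤ f ≤ M`, `Ent_{μ⊗ν}(f) ≤ ∫ Ent_ν(f(x,·)) dμ(x) + ∫ Ent_μ(f(·,y)) dν(y)` (chain rule + convexity).
[cite: BakryGentilLedoux2014, Prop. 5.2.7] -/
theorem entropy_prod_le {f : X × Y → ℝ} (hfm : Measurable f) {δ M : ℝ} (hδ : 0 < δ) (hfδ : ∀ p, δ ≤ f p) (hfM : ∀ p, f p ≤ M) :
    (∫ p, f p * Real.log (f p) ∂(μ.prod ν)) - (∫ p, f p ∂(μ.prod ν)) * Real.log (∫ p, f p ∂(μ.prod ν)) ≤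
      (∫ x, ((∫ y, f (x, y) * Real.log (f (x, y)) ∂ν) - (∫ y, f (x, y) ∂ν) * Real.log (∫ y, f (x, y) ∂ν)) ∂μ) +
      ∫ y, ((∫ x, f (x, y) * Real.log (f (x, y)) ∂μ) - (∫ x, f (x, y) ∂μ) * Real.log (∫ x, f (x, y) ∂μ)) ∂ν := by
  rw [entropy_prod_eq μ ν hfm hδ hfδ hfM]
  have h := entropy_marginal_le μ ν hfm hδ hfδ hfM
  linarith

end Product

end Summit.QuantumFields.YangMills.Theorems.ColdStartUniversality.EntropyFlow

end
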